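import Summits.BirchSwinnertonDyer.BirchSwinnertonDyer.Theorems.SylvesterTwoHeegnerIndexYinDefs
import Summits.BirchSwinnertonDyer.BirchSwinnertonDyer.Theorems.SylvesterTwoHeegnerIndexThmCOfTwoIntegral
import Summits.BirchSwinnertonDyer.BirchSwinnertonDyer.Theorems.SylvesterTwoHeegnerIndexUpperPairForm
import HarnessLib

/-!
# Route `SylvesterTwoHeegnerIndex` (rung K7t), item 19802 `HSYPointTwoDivisibleSevenModNine`
# (THEOREM C): the SINGLE-CURVE («Yin») layer in the engine currency — parity and range of
# `ord₂ #Ш_an(E_p)` for EVERY `p ≡ 4, 7 (mod 9)`, «C′ ⟺ 2-integrality», and **C′ ⟹ THEOREM C**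

Cell `bsd-cm`, seat `bsd-cm-two` (prover-bsd-cm-two-g8-0). PARTITION (D55): CornerF at `p = 2`
(B14/O12) × {`x³ + y³ = p` : `p ≡ 4, 7 (mod 9)` prime} × `p = 2` — types-the-object-of (kernel helper
`--supports stmt-BirchSwinnertonDyer-19802`); closes no cell and no item; BSD is not claimed.
Everything here is PROVED: no definition, no named fact, no `sorry`. The hypothesis shapes
`YinHeightDisplay` (Yin's 2026 PREPRINT display, one curve, no cube condition, up to a `2`-adic unit),
`YinPointTwoDivisibleSevenModNine` (CONJECTURE C′) and `ShaAnTwoIntegralSevenModNine` are the fact-free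
defs of `…Theorems.SylvesterTwoHeegnerIndexYinDefs`; the printed inputs (Hu–Shu–Yin's display and
Thm 1.4, Burungale–Flach / Rubin rank-`0` CM BSD, modularity) enter as HYPOTHESES by name, exactly as
in x1b's `…ThmCAssembly` and this seat's `…ThmCOfTwoIntegral`.

* §1 `padicValRat_two_unit_mul` — bookkeeping: `ord₂(u·q) = ord₂ q` for a `2`-adic unit `u`
  (`p ≠ 2` is `SylvesterTwoLower.ne_two_of_mod_nine`, reused).
* §2 **`exists_int_padicValRat_two_shaAn_eq_of_yinDisplay`** — for EVERY prime `p ≡ 4, 7 (mod 9)`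
  (3 may be a cube mod `p`) and every minimal `B ≅ E_p`: `#Ш_an(B) = qB ≠ 0` with `ord₂ qB = 2n`,
  `n ∈ ℤ`, `n ≥ 0 | −1` for `p ≡ 4 | 7 (9)` — parity by x1b's `even_padicValRat_two_of_model` (`2` inert
  in `ℤ[ω]`), range by this seat's `le_padicValRat_two_of_model` (the generator is not halvable); and
  `exists_nat_padicValRat_two_shaAn_eq_of_yinDisplay_mod_nine_eq_four` (`n ∈ ℕ` on `p ≡ 4 (9)`): the
  single-curve analogue of the route's `TwoAdicPairHSY`, no twin, no cube condition.
* §3 **`yinPoint_iff_shaAnTwoIntegral_of_yinDisplay`** — `YinHeightDisplay → (C′ ⟺ 0 ≤ ord₂ #Ш_an(E_p)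
  on p ≡ 7 (9))`: the `i = −2` engine `twoDivisible_iff_add_two_le_padicValRat_of_model` (p464849);
  and `exists_nat_padicValRat_two_shaAn_eq_of_yinDisplay_of_yinPoint` (`C′ ⟹ ord₂ #Ш_an(E_p) = 2n`,
  `n ∈ ℕ`, for EVERY `p ≡ 4, 7 (9)`).
* §4 **`hsyPointTwoDivisibleSevenModNine_of_yinPoint`** — C′ ⟹ THEOREM C (typed, 19802's universe)
  granted: Hu–Shu–Yin Thm 1.4 + display (PRINT), Burungale–Flach rank-`0` CM BSD (PRINT), modularity,
  and Yin's display: because `ord₂ #Ш_an(E_{3p²}) = ord₂ #Ш(E_{3p²})[2^∞] ≥ 0` is a THEOREM for the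
  rank-`0` CM twin (`SylvesterTwoUpper.pair_shaAn_two`), the single-curve integrality gives the pair
  integrality, which IS THEOREM C modulo the display (p464849). In the route's own words:
  **`hsyPointTwoDivisibleSevenModNine_of_factsPlus_of_yin : PublishedFactsTwoPlus → YinHeightDisplay →
  YinPointTwoDivisibleSevenModNine → Theses.….HSYPointTwoDivisibleSevenModNine`** (the live item 19802
  BY NAME). And the honest STRENGTHENING that C′ carries: `pairProduct_ge_sha_partner_of_shaAnTwoIntegral`
  — C′ ⟹ `ord₂ #Ш(E_{3p²})[2^∞] ≤ ord₂(#Ш_an(E_p)·#Ш_an(E_{3p²}))`, i.e. Hu–Shu–Yin's point is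
  `2`-divisible BEYOND Theorem C by the `2`-part of the twin's Ш (the twin side of the LOWER half).

* §4 (converse, pointwise) `shaAn_two_nonneg_of_pairProductTwoIntegral_of_sha_partner_trivial` —
  THEOREM C gives C′ at every 𝒞_HSY prime whose twin has `Ш(E_{3p²})[2^∞] = 1`.
* §5 **the single-curve `𝒱₀(B)` layer**: `missingUpperBoundAt_two_of_yinDisplay_mod_nine_eq_four`
  (p ≡ 4 (9): display ⟹ `MissingUpperBoundAt B 2` whenever `ord₂ #Ш(B) = 0` — no twin, no cube
  condition), `missingUpperBoundAt_two_of_yinDisplay_of_shaAnTwoIntegral` (p ≡ 7 (9), modulo C′), and in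
  the vocabulary of the off-`𝒱₀` crux 19804 `UpperOffV0HSYPlus`:
  **`missingUpperBoundAt_two_of_yin_of_sha_two_trivial`** — its TWIN-ONLY rows (`Ш(E_p)[2^∞] = 1`,
  `Ш(E_{3p²})[2^∞] ≠ 1`: the majority of the off-`𝒱₀` census) hold modulo the display (+ C′ on p ≡ 7 (9)).

* §6 (v2) **`upperOffV0HSYPlus_of_yin_of_offV0B`** — the off-`𝒱₀` crux 19804 `UpperOffV0HSYPlus` BY NAME
  from Yin's display + C′ + the displayed SINGLE-CURVE residual «`MissingUpperBoundAt B 2` for the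
  members with `Ш(E_p)[2^∞] ≠ 1`» (the twin no longer occurs). A reduction, not a proof.

HONEST READING. Nothing here proves C′ or THEOREM C. §4 says: the single-curve conjecture C′ (about
Yin's point, 22/22 numerically, MEMO §44) is a SUFFICIENT condition for item 19802 modulo print and a
preprint display, and is stronger than THEOREM C exactly by the twin's `Ш[2^∞]`; §5 says the twin's Ш is
irrelevant to the Euler-system half of BSD₂(E_p) once Yin's display is granted. MEMO bsd-cm-two v2.9 §46–§47.

## References
* H. Yin, arXiv:2607.01744 (2026), Thm. 1.1, (3.5.3), p. 12 (PREPRINT); arXiv:2605.25917 (2026).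
* Y. Hu, J. Shu, H. Yin, Trans. AMS 372 (2019) = arXiv:1708.05266, Thm. 1.4, Cor. 4.4, display (bsd) p. 12.
* A. Burungale, M. Flach, Camb. J. Math. 12 (2024), Thm. 1.1 / Cor. 2 (rank-0 CM BSD at every prime).
* MEMO bsd-cm-two v2.8 §39/§42/§44 (HOME/frozen/MEMO-bsd-cm-two.v2.8.7b10bbdf24ce5e05.md); v2.9 §46–§47.
-/

set_option autoImplicit false
-- the Summit-side namespace `Summit.BirchSwinnertonDyer.BirchSwinnertonDyer.…` (summit = problem) is mandated by D-0017
set_option linter.dupNamespace false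

noncomputable section

open scoped Classical

open WeierstrassCurve WeierstrassCurve.Affine WeierstrassCurve.Affine.Point
  Summit.BirchSwinnertonDyer.BirchSwinnertonDyer.Theorems.SylvesterTwoCMNormForm
  Summit.BirchSwinnertonDyer.BirchSwinnertonDyer.Theorems.SylvesterTwoNonneg
  Summit.BirchSwinnertonDyer.BirchSwinnertonDyer.Theorems.SylvesterTwoThmCAssembly
  Literature.NumberTheory.EllipticCurves Literature.NumberTheory.EllipticCurves.HuShuYin2019

namespace Summit.BirchSwinnertonDyer.BirchSwinnertonDyer.Theorems.SylvesterTwoYin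

/-! ## §1 Bookkeeping: a `2`-adic unit does not move `ord₂` -/

/-- `ord₂(u·q) = ord₂ q` when `u ≠ 0`, `q ≠ 0` and `ord₂ u = 0`. [folklore] -/
theorem padicValRat_two_unit_mul {u q : ℚ} (hu0 : u ≠ 0) (hq : q ≠ 0) (hu : padicValRat 2 u = 0) :
    padicValRat 2 (u * q) = padicValRat 2 q := by
  rw [padicValRat.mul hu0 hq, hu, zero_add]

/-- The display exponent `2δ ∈ {0, −2}` is even. [folklore] -/
theorem even_displayExponent (p : ℕ) : Even (if p % 9 = 4 then (0 : ℤ) else -2) := by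
  split_ifs
  · exact ⟨0, rfl⟩
  · exact ⟨-1, rfl⟩

/-! ## §2 Parity and range of `ord₂ #Ш_an(E_p)` for every `p ≡ 4, 7 (mod 9)` -/

/-- **SINGLE-CURVE PARITY AND RANGE.** Granted Yin's display: for every prime `p ≡ 4, 7 (mod 9)`
(no condition on `3 mod p`) and every globally minimal `B ≅ E_p`, `#Ш_an(B) = qB ≠ 0` is rational and
`ord₂ qB = 2n` with `n ∈ ℤ`, `n ≥ 0` if `p ≡ 4 (9)` and `n ≥ −1` if `p ≡ 7 (9)`. Proof at
`K = ℚ(ζ₃)`: the display gives `(u·qB)·ĥ(ι P) = 2^{2δ}·ĥ(Y)`; `ord₂(u·qB)` is EVEN by x1b's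
`even_padicValRat_two_of_model` (norm form, `2` inert in `ℤ[ω]`) and `≥ 2δ` by
`le_padicValRat_two_of_model` (the rational generator is not halvable); `ord₂ u = 0`.
[cite-level reading: arXiv:2607.01744 Thm. 1.1, (3.5.3); HuShuYin2019 p. 8] -/
theorem exists_int_padicValRat_two_shaAn_eq_of_yinDisplay (hY : YinHeightDisplay) {p : ℕ}
    (hp : p.Prime) (h9 : p % 9 = 4 ∨ p % 9 = 7) (B : WeierstrassCurve ℚ) [B.IsElliptic]
    [B.IsGloballyMinimal] (hB : ∃ C : VariableChange ℚ, C • B = cubeSumCurve (p : ℚ)) :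
    ∃ qB : ℚ, shaAn B = (qB : ℂ) ∧ qB ≠ 0 ∧
      ∃ n : ℤ, padicValRat 2 qB = 2 * n ∧ (if p % 9 = 4 then (0 : ℤ) else -1) ≤ n := by
  obtain ⟨ω, hω⟩ := exists_omega_cyclotomicField_three
  have h2K := finrank_cyclotomicField_three
  obtain ⟨qB, hqB, hq0, hrank, P, Y, u, hu0, hu, hP, hgen, hid⟩ :=
    hY p hp h9 B hB (CyclotomicField 3 ℚ) ω hω h2K
  obtain ⟨C, hC⟩ := hB
  have hp2 : p ≠ 2 := SylvesterTwoLower.ne_two_of_mod_nine h9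
  have huq : u * qB ≠ 0 := mul_ne_zero hu0 hq0
  have hval : padicValRat 2 (u * qB) = padicValRat 2 qB := padicValRat_two_unit_mul hu0 hq0 hu
  have hpar := even_padicValRat_two_of_model hω B C hC hrank hP Y huq (even_displayExponent p) hid
  have hle := le_padicValRat_two_of_model hω h2K hp hp2 B C hC hrank P hP hgen Y huq hid
  rw [hval] at hpar hle
  obtain ⟨n, hn⟩ := hpar
  refine ⟨qB, hqB, hq0, n, by rw [hn]; ring, ?_⟩
  rw [hn] at hle
  split_ifs at hle ⊢ <;> omega

/-- **`p ≡ 4 (mod 9)`: `ord₂ #Ш_an(E_p) = 2n`, `n ∈ ℕ`, for EVERY such prime** (no cube condition),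
granted Yin's display — the single-curve analogue of the route's `TwoAdicPairHSY` on this class.
[cite-level reading: arXiv:2607.01744 Thm. 1.1, (3.5.3); HuShuYin2019 p. 8] -/
theorem exists_nat_padicValRat_two_shaAn_eq_of_yinDisplay_mod_nine_eq_four (hY : YinHeightDisplay)
    {p : ℕ} (hp : p.Prime) (h4 : p % 9 = 4) (B : WeierstrassCurve ℚ) [B.IsElliptic]
    [B.IsGloballyMinimal] (hB : ∃ C : VariableChange ℚ, C • B = cubeSumCurve (p : ℚ)) :
    ∃ qB : ℚ, shaAn B = (qB : ℂ) ∧ qB ≠ 0 ∧ ∃ n : ℕ, padicValRat 2 qB = 2 * n := by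
  obtain ⟨qB, hqB, hq0, n, hn, hle⟩ :=
    exists_int_padicValRat_two_shaAn_eq_of_yinDisplay hY hp (Or.inl h4) B hB
  rw [if_pos h4] at hle
  exact ⟨qB, hqB, hq0, n.toNat, by rw [hn, Int.toNat_of_nonneg hle]⟩

/-! ## §3 CONJECTURE C′ ⟺ the `2`-integrality of `#Ш_an(E_p)` on `p ≡ 7 (mod 9)` -/

/-- **C′ ⟺ `2`-INTEGRALITY (single curve), modulo Yin's display.** Granted `YinHeightDisplay`:
`YinPointTwoDivisibleSevenModNine ↔ ShaAnTwoIntegralSevenModNine`. `→`: at `K = ℚ(ζ₃)` the display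
supplies a point `Y` in position `i = −2`; C′ makes it `2`-divisible modulo torsion, so
`0 = i + 2 ≤ ord₂(u·qB) = ord₂ qB` (`add_two_le_padicValRat_two_of_model_of_twoDivisible`). `←`: for any
`Y` in position `i = −2` at any quadratic `K ∋ ω`, `0 ≤ ord₂ qB` is `i + 2 ≤ ord₂(u·qB)`, and the
`2`-divisibility descent `exists_eq_two_smul_add_torsion_of_model_of_le_padicValRat` (p464849) gives
`Y ∈ 2·B(K) + tors` (the display supplies `rank_ℤ B(K) = 2` and `qB ≠ 0` at that `K`).
[cite-level reading: arXiv:2607.01744 Thm. 1.1, p. 12; HuShuYin2019 pp. 8, 12] -/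
theorem yinPoint_iff_shaAnTwoIntegral_of_yinDisplay (hY : YinHeightDisplay) :
    YinPointTwoDivisibleSevenModNine ↔ ShaAnTwoIntegralSevenModNine := by
  constructor
  · intro hC p hp h7 B _ _ hB qB hqB
    obtain ⟨ω, hω⟩ := exists_omega_cyclotomicField_three
    have h2K := finrank_cyclotomicField_three
    obtain ⟨qB', hqB', hq0, hrank, P, Y, u, hu0, hu, hP, hgen, hid⟩ :=
      hY p hp (Or.inr h7) B hB (CyclotomicField 3 ℚ) ω hω h2K
    have e : qB' = qB := by exact_mod_cast hqB'.symm.trans hqB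
    subst e
    have h74 : ¬ p % 9 = 4 := by omega
    rw [if_neg h74] at hid
    have h2div := hC p hp h7 B hB qB' hqB (CyclotomicField 3 ℚ) ω hω h2K P hP hgen Y u hu0 hu hid
    obtain ⟨C, hC⟩ := hB
    have hp2 : p ≠ 2 := SylvesterTwoLower.ne_two_of_mod_nine (Or.inr h7)
    have huq : u * qB' ≠ 0 := mul_ne_zero hu0 hq0
    have h := add_two_le_padicValRat_two_of_model_of_twoDivisible hω h2K hp hp2 B C hC hrank P hP
      hgen Y huq hid h2div
    rw [padicValRat_two_unit_mul hu0 hq0 hu] at h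
    linarith
  · intro hI p hp h7 B _ _ hB qB hqB K _ _ ω hω h2K P₀ hP hgen Y u hu0 hu hid
    obtain ⟨qB', hqB', hq0, hrank, -⟩ := hY p hp (Or.inr h7) B hB K ω hω h2K
    have e : qB' = qB := by exact_mod_cast hqB'.symm.trans hqB
    subst e
    have h0 : 0 ≤ padicValRat 2 qB' := hI p hp h7 B hB qB' hqB
    obtain ⟨C, hC⟩ := hB
    have hp2 : p ≠ 2 := SylvesterTwoLower.ne_two_of_mod_nine (Or.inr h7)
    have huq : u * qB' ≠ 0 := mul_ne_zero hu0 hq0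
    exact exists_eq_two_smul_add_torsion_of_model_of_le_padicValRat hω h2K hp hp2 B C hC hrank P₀ hP
      hgen Y huq hid (by rw [padicValRat_two_unit_mul hu0 hq0 hu]; linarith)

/-- **C′ ⟹ `ord₂ #Ш_an(E_p) = 2n`, `n ∈ ℕ`, for EVERY prime `p ≡ 4, 7 (mod 9)`** (granted Yin's
display): the class `p ≡ 4 (9)` needs nothing (§2), the class `p ≡ 7 (9)` needs exactly C′ (§3) —
the single-curve form of «`#Ш_an(E_p)` is the norm of an element of `ℤ[ω]`», the shape BSD₂ predicts.
[cite-level reading: arXiv:2607.01744 Thm. 1.1, p. 12] -/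
theorem exists_nat_padicValRat_two_shaAn_eq_of_yinDisplay_of_yinPoint (hY : YinHeightDisplay)
    (hC : YinPointTwoDivisibleSevenModNine) {p : ℕ} (hp : p.Prime) (h9 : p % 9 = 4 ∨ p % 9 = 7)
    (B : WeierstrassCurve ℚ) [B.IsElliptic] [B.IsGloballyMinimal]
    (hB : ∃ C : VariableChange ℚ, C • B = cubeSumCurve (p : ℚ)) :
    ∃ qB : ℚ, shaAn B = (qB : ℂ) ∧ qB ≠ 0 ∧ ∃ n : ℕ, padicValRat 2 qB = 2 * n := by
  obtain ⟨qB, hqB, hq0, n, hn, hle⟩ := exists_int_padicValRat_two_shaAn_eq_of_yinDisplay hY hp h9 B hB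
  have hn0 : 0 ≤ n := by
    rcases h9 with h4 | h7
    · rw [if_pos h4] at hle; exact hle
    · have h0 : 0 ≤ padicValRat 2 qB :=
        (yinPoint_iff_shaAnTwoIntegral_of_yinDisplay hY).mp hC p hp h7 B hB qB hqB
      rw [hn] at h0; omega
  exact ⟨qB, hqB, hq0, n.toNat, by rw [hn, Int.toNat_of_nonneg hn0]⟩

/-! ## §4 C′ ⟹ THEOREM C (typed), granted print and the display; and what more C′ says -/

/-- **C′ ⟹ the `2`-integrality of the PAIR product** on 𝒞_HSY ∩ {p ≡ 7 (9)}: granted Hu–Shu–Yin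
Thm 1.4 (`hHSY`), Burungale–Flach / Rubin rank-`0` CM BSD (`hCM0`), modularity (`hmod`) and Yin's
display, `ShaAnTwoIntegralSevenModNine → PairProductTwoIntegralSevenModNine`, because
`ord₂ #Ш_an(E_{3p²}) = ord₂ #Ш(E_{3p²})[2^∞] ≥ 0` (`SylvesterTwoUpper.pair_shaAn_two`).
[cite: HuShuYin2019, Thm. 1.3 / 1.4 and p. 4] [cite: BurungaleFlach2024, Thm. 1.1 and Cor. 2]
[cite: Miller2011LMS, Def. 1.1] -/
theorem pairProductTwoIntegral_of_shaAnTwoIntegral (hHSY : thm14_threePart_product)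
    (hCM0 : bsdTriple_of_hasCM_of_L_one_ne_zero) (hmod : hasEntireLFunction_rat)
    (hI : ShaAnTwoIntegralSevenModNine) : PairProductTwoIntegralSevenModNine := by
  intro p hp h7 h3 A B _ _ _ _ hB hA qB qA hqB hqA
  have h0 : 0 ≤ padicValRat 2 qB := hI p hp h7 B hB qB hqB
  obtain ⟨-, -, qB', qA', hqB', hqA', hqB0, hqA0, hvA⟩ :=
    SylvesterTwoUpper.pair_shaAn_two hHSY hCM0 hmod hp (Or.inr h7) h3 A B hB hA
  have eB : qB' = qB := by exact_mod_cast hqB'.symm.trans hqB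
  have eA : qA' = qA := by exact_mod_cast hqA'.symm.trans hqA
  subst eB eA
  have hA0 : 0 ≤ padicValRat 2 qA' := by rw [hvA]; exact_mod_cast Nat.zero_le _
  rw [padicValRat.mul hqB0 hqA0]
  linarith

/-- **CONJECTURE C′ ⟹ THEOREM C (typed form `SylvesterTwoNonneg.HSYPointTwoDivisibleSevenModNine`).**
Granted Hu–Shu–Yin Thm 1.4 and display (PRINT), Burungale–Flach / Rubin rank-`0` CM BSD (PRINT),
modularity, and Yin's display (PREPRINT shape): if Yin's point is `2`-divisible modulo torsion for every
`p ≡ 7 (9)` (C′), then so is Hu–Shu–Yin's (THEOREM C, for `3 ∉ 𝔽_p^{×3}`): §3 turns C′ into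
`0 ≤ ord₂ #Ш_an(E_p)`, the twin contributes `ord₂ #Ш_an(E_{3p²}) ≥ 0` (a theorem: rank `0`, CM), and
`hsyPointTwoDivisibleSevenModNine_of_heightDisplay_of_twoIntegral` (p464849) concludes.
[cite: HuShuYin2019, Thm. 1.4 and display (bsd) p. 12] [cite: BurungaleFlach2024, Thm. 1.1 and Cor. 2] -/
theorem hsyPointTwoDivisibleSevenModNine_of_yinPoint (hHSY : thm14_threePart_product)
    (hCM0 : bsdTriple_of_hasCM_of_L_one_ne_zero) (hmod : hasEntireLFunction_rat)
    (hH : shaAnPair_mul_height_eq_two_zpow_mul_height) (hY : YinHeightDisplay)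
    (hC : YinPointTwoDivisibleSevenModNine) : HSYPointTwoDivisibleSevenModNine :=
  hsyPointTwoDivisibleSevenModNine_of_heightDisplay_of_twoIntegral hH
    (pairProductTwoIntegral_of_shaAnTwoIntegral hHSY hCM0 hmod
      ((yinPoint_iff_shaAnTwoIntegral_of_yinDisplay hY).mp hC))

/-- **The live item 19802 BY NAME from C′.** Granted the route's support conjunction
`PublishedFactsTwoPlus` (19724: `PublishedFactsTwo` ∧ Hu–Shu–Yin's display) and Yin's display:
`YinPointTwoDivisibleSevenModNine → Theses.SylvesterTwoHeegnerIndex.HSYPointTwoDivisibleSevenModNine`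
(the cascade-v2 child, whose inlined body is definitionally `SylvesterTwoNonneg.HSYPointTwoDivisibleSevenModNine`).
So the SINGLE-CURVE conjecture C′ is a sufficient condition for crux r201 modulo print + a preprint
display. Nothing is closed: C′ is open. [cite: HuShuYin2019, Thm. 1.4 and display (bsd) p. 12]
[cite: BurungaleFlach2024, Thm. 1.1 and Cor. 2] -/
theorem hsyPointTwoDivisibleSevenModNine_of_factsPlus_of_yin
    (hFP : Theses.SylvesterTwoHeegnerIndex.PublishedFactsTwoPlus) (hY : YinHeightDisplay)
    (hC : YinPointTwoDivisibleSevenModNine) :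
    Theses.SylvesterTwoHeegnerIndex.HSYPointTwoDivisibleSevenModNine := by
  obtain ⟨⟨hHSY, hCM0, hmod, -⟩, hH⟩ := hFP
  exact hsyPointTwoDivisibleSevenModNine_of_yinPoint hHSY hCM0 hmod hH hY hC

/-- **WHAT C′ SAYS BEYOND THEOREM C: the twin side of the LOWER half.** Granted Hu–Shu–Yin Thm 1.4,
Burungale–Flach / Rubin and modularity: `ShaAnTwoIntegralSevenModNine` implies, for every 𝒞_HSY prime
`p ≡ 7 (9)` and all minimal `B ≅ E_p`, `A ≅ E_{3p²}`,
`ord₂ #Ш(A)[2^∞] ≤ ord₂(#Ш_an(B)·#Ш_an(A))` — i.e. Hu–Shu–Yin's Heegner point is `2`-divisible not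
just once (THEOREM C: `0 ≤ …`) but by `2^{1 + ord₂ √#Ш(E_{3p²})}` in the `ℤ₂[ω]`-line: the `2`-part of
the twin's Ш forces extra divisibility of the pair's Heegner index (the `A`-side of the main-conjecture
half). [cite: HuShuYin2019, Thm. 1.4 and display (bsd) p. 12] [cite: BurungaleFlach2024, Thm. 1.1 and Cor. 2]
[cite: Miller2011LMS, Def. 1.1] -/
theorem pairProduct_ge_sha_partner_of_shaAnTwoIntegral (hHSY : thm14_threePart_product)
    (hCM0 : bsdTriple_of_hasCM_of_L_one_ne_zero) (hmod : hasEntireLFunction_rat)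
    (hI : ShaAnTwoIntegralSevenModNine) {p : ℕ} (hp : p.Prime) (h7 : p % 9 = 7)
    (h3 : ¬ ∃ x : ZMod p, x ^ 3 = 3) (A B : WeierstrassCurve ℚ) [A.IsElliptic] [A.IsGloballyMinimal]
    [B.IsElliptic] [B.IsGloballyMinimal] (hB : ∃ C : VariableChange ℚ, C • B = cubeSumCurve (p : ℚ))
    (hA : ∃ C : VariableChange ℚ, C • A = cubeSumCurve (3 * (p : ℚ) ^ 2)) :
    ∃ qB qA : ℚ, shaAn B = (qB : ℂ) ∧ shaAn A = (qA : ℂ) ∧ qB * qA ≠ 0 ∧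
      (padicValNat 2 (Nat.card (AddCommGroup.primaryComponent A.sha 2)) : ℤ) ≤
        padicValRat 2 (qB * qA) := by
  obtain ⟨-, -, qB, qA, hqB, hqA, hqB0, hqA0, hvA⟩ :=
    SylvesterTwoUpper.pair_shaAn_two hHSY hCM0 hmod hp (Or.inr h7) h3 A B hB hA
  have h0 : 0 ≤ padicValRat 2 qB := hI p hp h7 B hB qB hqB
  refine ⟨qB, qA, hqB, hqA, mul_ne_zero hqB0 hqA0, ?_⟩
  rw [padicValRat.mul hqB0 hqA0, hvA]
  linarith

/-- **Conversely, THEOREM C gives C′ pointwise where the twin's Ш has odd order.** Granted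
Hu–Shu–Yin Thm 1.4, Burungale–Flach / Rubin and modularity: if the PAIR product is `2`-integral on
`p ≡ 7 (9)` (`PairProductTwoIntegralSevenModNine`, i.e. THEOREM C read through the display) then at
every 𝒞_HSY prime `p ≡ 7 (9)` admitting a minimal twin `A ≅ E_{3p²}` with `Ш(A)[2^∞] = 1`,
`0 ≤ ord₂ #Ш_an(E_p)` — C′ at that `p` (through Yin's display, §3). So C′ is a cell theorem modulo
print + preprint on {`3 ∉ 𝔽_p^{×3}`, `#Ш(E_{3p²})` odd}; elsewhere it is open.
[cite: HuShuYin2019, Thm. 1.4 and display (bsd) p. 12] [cite: BurungaleFlach2024, Thm. 1.1 and Cor. 2]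
[cite: Miller2011LMS, Def. 1.1] -/
theorem shaAn_two_nonneg_of_pairProductTwoIntegral_of_sha_partner_trivial
    (hHSY : thm14_threePart_product) (hCM0 : bsdTriple_of_hasCM_of_L_one_ne_zero)
    (hmod : hasEntireLFunction_rat) (hI : PairProductTwoIntegralSevenModNine) {p : ℕ} (hp : p.Prime)
    (h7 : p % 9 = 7) (h3 : ¬ ∃ x : ZMod p, x ^ 3 = 3) (A B : WeierstrassCurve ℚ) [A.IsElliptic]
    [A.IsGloballyMinimal] [B.IsElliptic] [B.IsGloballyMinimal]
    (hB : ∃ C : VariableChange ℚ, C • B = cubeSumCurve (p : ℚ))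
    (hA : ∃ C : VariableChange ℚ, C • A = cubeSumCurve (3 * (p : ℚ) ^ 2))
    (hA1 : Nat.card (AddCommGroup.primaryComponent A.sha 2) = 1) {qB : ℚ}
    (hqB : shaAn B = (qB : ℂ)) : 0 ≤ padicValRat 2 qB := by
  obtain ⟨-, -, qB', qA, hqB', hqA, hqB0, hqA0, hvA⟩ :=
    SylvesterTwoUpper.pair_shaAn_two hHSY hCM0 hmod hp (Or.inr h7) h3 A B hB hA
  have e : qB' = qB := by exact_mod_cast hqB'.symm.trans hqB
  subst e
  have h := hI p hp h7 h3 A B hB hA qB' qA hqB hqA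
  rw [padicValRat.mul hqB0 hqA0, hvA, hA1] at h
  simpa using h

/-! ## §5 The single-curve `𝒱₀(B)` layer: the Euler-system half of BSD₂(E_p) where `Ш(E_p)[2^∞]`
is trivial — the twin drops out -/

/-- **UPPER half on `𝒱₀(B)`, class `p ≡ 4 (mod 9)`, NO twin and NO cube condition.** Granted Yin's
display: for every prime `p ≡ 4 (9)` and every minimal `B ≅ E_p` whose `#Ш` has trivial `2`-part
(`ord₂ #Ш(B) = 0`, Miller's `shaOrder` currency), `MissingUpperBoundAt B 2` — because
`ord₂ #Ш_an(B) = 2n ≥ 0` (§2). Compare the route's `𝒱₀` layer (p431798), which needs BOTH `Ш(B)[2^∞]`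
and `Ш(A)[2^∞]` trivial: with the single-curve display the twin's Ш is irrelevant.
[cite-level reading: arXiv:2607.01744 Thm. 1.1] [cite: Miller2011LMS, Def. 1.1] -/
theorem missingUpperBoundAt_two_of_yinDisplay_mod_nine_eq_four (hY : YinHeightDisplay) {p : ℕ}
    (hp : p.Prime) (h4 : p % 9 = 4) (B : WeierstrassCurve ℚ) [B.IsElliptic] [B.IsGloballyMinimal]
    (hB : ∃ C : VariableChange ℚ, C • B = cubeSumCurve (p : ℚ)) (hSha : padicValNat 2 B.shaOrder = 0) :
    Rank1Residual.Typed.MissingUpperBoundAt B 2 := by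
  obtain ⟨qB, hqB, -, n, hn⟩ :=
    exists_nat_padicValRat_two_shaAn_eq_of_yinDisplay_mod_nine_eq_four hY hp h4 B hB
  refine ⟨qB, hqB, ?_⟩
  rw [hSha, hn]
  push_cast
  positivity

/-- **UPPER half on `𝒱₀(B)`, class `p ≡ 7 (mod 9)`, modulo C′ (as `2`-integrality).** Granted Yin's
display and `ShaAnTwoIntegralSevenModNine`: for every prime `p ≡ 7 (9)` and every minimal `B ≅ E_p`
with `ord₂ #Ш(B) = 0`, `MissingUpperBoundAt B 2`. [cite-level reading: arXiv:2607.01744 Thm. 1.1, p. 12]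
[cite: Miller2011LMS, Def. 1.1] -/
theorem missingUpperBoundAt_two_of_yinDisplay_of_shaAnTwoIntegral (hY : YinHeightDisplay)
    (hI : ShaAnTwoIntegralSevenModNine) {p : ℕ} (hp : p.Prime) (h7 : p % 9 = 7)
    (B : WeierstrassCurve ℚ) [B.IsElliptic] [B.IsGloballyMinimal]
    (hB : ∃ C : VariableChange ℚ, C • B = cubeSumCurve (p : ℚ)) (hSha : padicValNat 2 B.shaOrder = 0) :
    Rank1Residual.Typed.MissingUpperBoundAt B 2 := by
  obtain ⟨ω, hω⟩ := exists_omega_cyclotomicField_three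
  obtain ⟨qB, hqB, -⟩ := hY p hp (Or.inr h7) B hB (CyclotomicField 3 ℚ) ω hω finrank_cyclotomicField_three
  refine ⟨qB, hqB, ?_⟩
  rw [hSha]
  push_cast
  exact hI p hp h7 B hB qB hqB

/-- **THE TWIN-ONLY ROWS OF THE OFF-`𝒱₀` CRUX (19804 `UpperOffV0HSYPlus`) ARE DISCHARGED MODULO YIN'S
DISPLAY (+ C′ on `p ≡ 7 (9)`).** Granted Hu–Shu–Yin Thm 1.4 (for the finiteness of `Ш(E_p)`), Yin's
display and C′: for every 𝒞_HSY member `B ≅ E_p` with `Ш(B)[2^∞] = 1` — WHATEVER the twin's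
`Ш(E_{3p²})[2^∞]` — the Euler-system half `MissingUpperBoundAt B 2` holds. So, modulo the preprint
display (and C′ on one class), the off-`𝒱₀` crux reduces to the members with `Ш(E_p)[2] ≠ 0` itself
(census: `Ш(E_p)[2] ≠ 0` on 28 of 279 members `p ≡ 4 (9)`, `p ≤ 2·10⁴`, against `Ш(E_{3p²})[2] ≠ 0` on
292 of 524 twins — N6-TABLE T2). Nothing is closed: the display is a hypothesis and C′ is open.
[cite: HuShuYin2019, Thm. 1.3 / 1.4] [cite-level reading: arXiv:2607.01744 Thm. 1.1, p. 12]
[cite: Miller2011LMS, Def. 1.1] -/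
theorem missingUpperBoundAt_two_of_yin_of_sha_two_trivial (hHSY : thm14_threePart_product)
    (hY : YinHeightDisplay) (hC : YinPointTwoDivisibleSevenModNine) {p : ℕ} (hp : p.Prime)
    (h9 : p % 9 = 4 ∨ p % 9 = 7) (h3 : ¬ ∃ x : ZMod p, x ^ 3 = 3) (A B : WeierstrassCurve ℚ)
    [A.IsElliptic] [A.IsGloballyMinimal] [B.IsElliptic] [B.IsGloballyMinimal]
    (hB : ∃ C : VariableChange ℚ, C • B = cubeSumCurve (p : ℚ))
    (hA : ∃ C : VariableChange ℚ, C • A = cubeSumCurve (3 * (p : ℚ) ^ 2))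
    (hB1 : Nat.card (AddCommGroup.primaryComponent B.sha 2) = 1) :
    Rank1Residual.Typed.MissingUpperBoundAt B 2 := by
  haveI : Fact (2 : ℕ).Prime := ⟨Nat.prime_two⟩
  obtain ⟨-, -, hfinB, -⟩ := hHSY p hp h9 h3 A B hB hA
  haveI : Finite B.sha := hfinB
  have hSha : padicValNat 2 B.shaOrder = 0 := by
    rw [WeierstrassCurve.shaOrder, ← padicValNat_card_addPrimaryComponent 2, hB1]; simp
  rcases h9 with h4 | h7
  · exact missingUpperBoundAt_two_of_yinDisplay_mod_nine_eq_four hY hp h4 B hB hSha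
  · exact missingUpperBoundAt_two_of_yinDisplay_of_shaAnTwoIntegral hY
      ((yinPoint_iff_shaAnTwoIntegral_of_yinDisplay hY).mp hC) hp h7 B hB hSha

/-! ## §6 The off-`𝒱₀` crux 19804 `UpperOffV0HSYPlus` from its SINGLE-CURVE residual (v2, append-only) -/

/-- **19804 `UpperOffV0HSYPlus` ⟸ Yin's display + C′ + the single-curve off-`𝒱₀(B)` residual.**
Granted `YinHeightDisplay` and CONJECTURE C′, the off-`𝒱₀` crux of the K7t cascade (the Euler-system
half `MissingUpperBoundAt B 2` at every 𝒞_HSY pair with `Ш(E_p)[2^∞] ≠ 1 ∨ Ш(E_{3p²})[2^∞] ≠ 1`,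
granted `PublishedFactsTwoPlus`) follows from the displayed SINGLE-CURVE residual `hoffB`: «granted the
same facts, `MissingUpperBoundAt B 2` for every member `B ≅ E_p` with `Ш(B)[2^∞] ≠ 1`» — the twin's
`Ш(E_{3p²})` no longer occurs (the twin-only rows are §5's
`missingUpperBoundAt_two_of_yin_of_sha_two_trivial`). This is a REDUCTION of 19804 modulo a PREPRINT
display and the open C′, not a proof of any row of it; `hoffB` is the genuine Kolyvagin-at-`2` content
(the members with `(ℤ/2)² ⊆ Ш(E_p)`: k7t-c2's line offv0-kolyvagin2). Nothing is closed.
[cite: HuShuYin2019, Thm. 1.4 and display (bsd) p. 12] [cite-level reading: arXiv:2607.01744 Thm. 1.1]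
[cite: Miller2011LMS, Def. 1.1] -/
theorem upperOffV0HSYPlus_of_yin_of_offV0B (hY : YinHeightDisplay)
    (hC : YinPointTwoDivisibleSevenModNine)
    (hoffB : Theses.SylvesterTwoHeegnerIndex.PublishedFactsTwoPlus →
      ∀ (p : ℕ), p.Prime → (p % 9 = 4 ∨ p % 9 = 7) → (¬ ∃ x : ZMod p, x ^ 3 = 3) →
        ∀ (B : WeierstrassCurve ℚ) [B.IsElliptic] [B.IsGloballyMinimal],
          (∃ C : VariableChange ℚ, C • B = cubeSumCurve (p : ℚ)) →
          Nat.card (AddCommGroup.primaryComponent B.sha 2) ≠ 1 →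
          Rank1Residual.Typed.MissingUpperBoundAt B 2) :
    Theses.SylvesterTwoHeegnerIndex.UpperOffV0HSYPlus := by
  intro hFP p hp h9 h3 A B _ _ _ _ hB hA _
  by_cases hB1 : Nat.card (AddCommGroup.primaryComponent B.sha 2) = 1
  · exact missingUpperBoundAt_two_of_yin_of_sha_two_trivial hFP.1.1 hY hC hp h9 h3 A B hB hA hB1
  · exact hoffB hFP p hp h9 h3 B hB hB1

end Summit.BirchSwinnertonDyer.BirchSwinnertonDyer.Theorems.SylvesterTwoYin

end
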